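import Mathlib
import HarnessLib
import HarnessLib.Audit
import Summits.CriticalPhenomena.Statement
import Literature.Probability.RandomPlanarGeometry.SLE
import Literature.Probability.LatticeModels.MedialWinding

/-!
# Restatement probe (lead c6) — crux stmt-CriticalPhenomena-11293 `CardySusyWard.ParafermionPrecompact`

The paste-ready RESTATED text of the crux (rev-5 text verbatim + the two `edgeSet` guards; = the body of
`FourClassVertexTransfer.ParafermionPrecompactGuarded`, RESTATEMENT.md §2) elaborated STANDALONE in exactly the
context of the route file `Theses/CardySusyWard.lean` (same six imports, same namespace shape, same `open`s), so that
`ledger route edit … --restate ParafermionPrecompact --statement @guarded.txt` cannot bounce on elaboration.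
`restated_weaker` records that the restated text is implied by the typed one (nothing provable is lost).
-/

namespace Summit.CriticalPhenomena.CardyFormulaZ2.Cruxes.ParafermionPrecompact.RestateProbeC6

open scoped BigOperators Topology Manifold Classical MeasureTheory ProbabilityTheory Matrix InnerProductSpace ComplexConjugate ContinuousMap
open Filter Set Function TopologicalSpace MeasureTheory

/-- The restated (edge-guarded) text of `CardySusyWard.ParafermionPrecompact`, verbatim the content of `guarded.txt`. [folklore] -/
def ParafermionPrecompactRestated : Prop :=
  ∀ (D : Literature.Probability.RandomPlanarGeometry.DobrushinDomain) (Λ : ℝ → Literature.Probability.LatticeModels.DiscreteDobrushin), (∀ δ, (Λ δ).Ω = D.carrier) → (∀ δ, (Λ δ).δ = δ) → Filter.Tendsto (fun δ : ℝ => Metric.hausdorffEDist (Λ δ).arcA (D.arc 0)) (nhdsWithin (0:ℝ) (Set.Ioi 0)) (nhds 0) → Filter.Tendsto (fun δ : ℝ => Metric.hausdorffEDist (Λ δ).arcB (D.arc 1)) (nhdsWithin (0:ℝ) (Set.Ioi 0)) (nhds 0) → Filter.Tendsto (fun δ : ℝ => Metric.hausdorffEDist (Literature.Probability.LatticeModels.medialPoint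 δ '' (Λ δ).zdABEdges) {D.pt 0, D.pt 1}) (nhdsWithin (0:ℝ) (Set.Ioi 0)) (nhds 0) → (∀ᶠ δ in nhdsWithin (0:ℝ) (Set.Ioi 0), (Λ δ).IsZdAdmissible) → ∀ K : Set ℂ, IsCompact K → K ⊆ D.carrier → (∃ C : ℝ, ∀ᶠ δ in nhdsWithin (0:ℝ) (Set.Ioi 0), ∀ z : Literature.Probability.LatticeModels.MedialVertex, z ∈ (Literature.Probability.LatticeModels.zdGraph 2).edgeSet → Literature.Probability.LatticeModels.medialPoint δ z ∈ K → ‖(∫ ω, Literature.Probability.LatticeModels.passageSum (Literature.Probability.LatticeModels.medialExploration (Λ δ) ω) δ (1 / 3) z ∂(Literature.Probability.Percolation.bondPercolation (Literature.Probability.LatticeModels.zdGraph 2) Literature.Probability.Percolation.half))‖ ≤ C * δ ^ ((1:ℝ) / 3)) ∧ (∀ ε > (0:ℝ), ∃ η > (0:ℝ), ∀ᶠ δ in nhdsWithin (0:ℝ) (Set.Ioi 0), ∀ z z' : Literature.Probability.LatticeModels.MedialVertex, z ∈ (Literature.Probability.LatticeModels.zdGraph 2).edgeSet → z' ∈ (Literature.Probability.LatticeModels.zdGraph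 2).edgeSet → Literature.Probability.LatticeModels.medialPoint δ z ∈ K → Literature.Probability.LatticeModels.medialPoint δ z' ∈ K → dist (Literature.Probability.LatticeModels.medialPoint δ z) (Literature.Probability.LatticeModels.medialPoint δ z') < η → ‖(∫ ω, Literature.Probability.LatticeModels.passageSum (Literature.Probability.LatticeModels.medialExploration (Λ δ) ω) δ (1 / 3) z ∂(Literature.Probability.Percolation.bondPercolation (Literature.Probability.LatticeModels.zdGraph 2) Literature.Probability.Percolation.half)) - (∫ ω, Literature.Probability.LatticeModels.passageSum (Literature.Probability.LatticeModels.medialExploration (Λ δ) ω) δ (1 / 3) z' ∂(Literature.Probability.Percolation.bondPercolation (Literature.Probability.LatticeModels.zdGraph 2) Literature.Probability.Percolation.half))‖ ≤ ε * δ ^ ((1:ℝ) / 3))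

/-- The typed rev-5 text, verbatim (read back from the route file). [folklore] -/
def ParafermionPrecompactTypedReadback : Prop :=
  ∀ (D : Literature.Probability.RandomPlanarGeometry.DobrushinDomain) (Λ : ℝ → Literature.Probability.LatticeModels.DiscreteDobrushin), (∀ δ, (Λ δ).Ω = D.carrier) → (∀ δ, (Λ δ).δ = δ) → Filter.Tendsto (fun δ : ℝ => Metric.hausdorffEDist (Λ δ).arcA (D.arc 0)) (nhdsWithin (0:ℝ) (Set.Ioi 0)) (nhds 0) → Filter.Tendsto (fun δ : ℝ => Metric.hausdorffEDist (Λ δ).arcB (D.arc 1)) (nhdsWithin (0:ℝ) (Set.Ioi 0)) (nhds 0) → Filter.Tendsto (fun δ : ℝ => Metric.hausdorffEDist (Literature.Probability.LatticeModels.medialPoint δ '' (Λ δ).zdABEdges) {D.pt 0, D.pt 1}) (nhdsWithin (0:ℝ) (Set.Ioi 0)) (nhds 0) → (∀ᶠ δ in nhdsWithin (0:ℝ) (Set.Ioi 0), (Λ δ).IsZdAdmissible) → ∀ K : Set ℂ, IsCompact K → K ⊆ D.carrier → (∃ C : ℝ, ∀ᶠ δ in nhdsWithin (0:ℝ) (Set.Ioi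 0), ∀ z : Literature.Probability.LatticeModels.MedialVertex, Literature.Probability.LatticeModels.medialPoint δ z ∈ K → ‖(∫ ω, Literature.Probability.LatticeModels.passageSum (Literature.Probability.LatticeModels.medialExploration (Λ δ) ω) δ (1 / 3) z ∂(Literature.Probability.Percolation.bondPercolation (Literature.Probability.LatticeModels.zdGraph 2) Literature.Probability.Percolation.half))‖ ≤ C * δ ^ ((1:ℝ) / 3)) ∧ (∀ ε > (0:ℝ), ∃ η > (0:ℝ), ∀ᶠ δ in nhdsWithin (0:ℝ) (Set.Ioi 0), ∀ z z' : Literature.Probability.LatticeModels.MedialVertex, Literature.Probability.LatticeModels.medialPoint δ z ∈ K → Literature.Probability.LatticeModels.medialPoint δ z' ∈ K → dist (Literature.Probability.LatticeModels.medialPoint δ z) (Literature.Probability.LatticeModels.medialPoint δ z') < η → ‖(∫ ω, Literature.Probability.LatticeModels.passageSum (Literature.Probability.LatticeModels.medialExploration (Λ δ) ω) δ (1 / 3) z ∂(Literature.Probability.Percolation.bondPercolation (Literature.Probability.LatticeModels.zdGraph 2) Literature.Probability.Percolation.half)) - (∫ ω, Literature.Probability.LatticeModels.passageSum (Literature.Probability.LatticeModels.medialExploration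 (Λ δ) ω) δ (1 / 3) z' ∂(Literature.Probability.Percolation.bondPercolation (Literature.Probability.LatticeModels.zdGraph 2) Literature.Probability.Percolation.half))‖ ≤ ε * δ ^ ((1:ℝ) / 3))

/-- The restatement only WEAKENS the item: typed text ⇒ restated text (specialise the unguarded clauses to edges). [folklore] -/
theorem restated_of_typed (h : ParafermionPrecompactTypedReadback) : ParafermionPrecompactRestated := by
  intro D Λ h1 h2 h3 h4 h5 h6 K hK hKD
  obtain ⟨⟨C, hC⟩, hii⟩ := h D Λ h1 h2 h3 h4 h5 h6 K hK hKD
  refine ⟨⟨C, hC.mono fun δ hδ z _ hz => hδ z hz⟩, fun ε hε => ?_⟩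
  obtain ⟨η, hη, hev⟩ := hii ε hε
  exact ⟨η, hη, hev.mono fun δ hδ z z' _ _ hz hz' hd => hδ z z' hz hz' hd⟩

end Summit.CriticalPhenomena.CardyFormulaZ2.Cruxes.ParafermionPrecompact.RestateProbeC6
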